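import Summits.QuantumFields.BalabanUV.T4Continuum.Support.NE3QbarNearFlat
import Summits.QuantumFields.BalabanUV.T4Continuum.Support.NE3QbarGaugeCovariance
import Summits.QuantumFields.BalabanUV.T4Continuum.Support.AveragingDeficitPeriodicCounting
import Summits.QuantumFields.BalabanUV.T4Continuum.Support.AveragingDeficitPlaqLin
import HarnessLib

/-!
# NE7QbarCurvedBaseLetter — THE ONE-LEVEL `ℓ¹` BASE-LIPSCHITZ LETTER OF THE LINEARISED DOUBLE-BAR AVERAGE AT A CURVED BACKGROUND:
# `Σ_{z,κ} ‖Q̄_U Y (z,κ) − Q̄_W Y (z,κ)‖ ≤ λ(r, a_U, a_W)·‖Y‖_{ℓ¹}` on the torus, for two small-field backgrounds `U`, `W` at RELATIVE link radius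
# `‖W⁻¹U − 1‖ ≤ r`, `λ = d(2n_b+1)^d·((2d+4)L²(2n_b·a_W + r) + (8L + C_sup)(loopRad a_U + loopRad a_W))` — letter (L4) ROAD B of the curved (APE) programme

Cell `pub-balaban`, rung (B)+1 sub-cell t4, lineage `b2b-balaban-t4-ne7-p1` (CRUX PROVER NE7 #1 = OWNER of row NE7), generation 76; memo
`t4/b2b-balaban-t4-ne7-p1-g75/CURVED-APE-ROAD.md` §2 (L4) ROAD B.  File F67 (over row NE3's W4a `NE3QbarNearFlat.norm_Qbar_sub_linQ_le` (the one-level reading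
against the flat straight average with BALL-LOCAL link hypotheses), W4c⁰ `NE3QbarGaugeCovariance.Qbar_gaugeAct` (`Q̄` dresses covariantly under ANY unitary gauge),
lit-balaban's axial gauge `B7Prop1Explicit.axialFn` ∕ `axial_bond_bound` (links within `|x − y|₁·a` of `1` from the plaquette radius alone), and the torus counting
`AveragingDeficitPeriodicCounting.sum_periodBox_box_le`).
WHY (memo §2 (L4)).  The tangent-transport letter (TT) of (APE) WITH A DATUM needs the `ℓ¹ → ℓ¹` size `Λ` of `Q̄^{(j+1)}_U − Q̄^{(j+1)}_W` for the representative
`U = W·e^{Z}` against its CURVED background `W` (at flat, F49b∕F50∕F51 compare with the flat straight tower `Q^{(j+1)}`; at a curved `W` no global gauge makes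
`W` near the identity).  ROAD B: per coarse bond `c`, BOTH backgrounds are read in ONE local axial gauge of `W` rooted at `c₋` — `W` is then within `n_b·a_W`
of `1` on the stencil ball of `c` (`n_b = nbRad = 2dL + 2L`), `U` within `n_b·a_W + r` (the relative link radius is gauge invariant) — the dressed direction
`Y^g` has the norms of `Y`, `Q̄` dresses covariantly, and W4a bounds each background against the COMMON flat straight average `L·Q₀(Y^g)`, which cancels in the
difference.  No locality lemma and no modification of the fields is needed: W4a's hypotheses are ball-local.  Summing over the torus with the box multiplicity
`(2n_b+1)^d` gives the one-level letter; the tower over the levels (Grönwall with `NE7MajorantL1`'s single-background `ℓ¹` norms) and the relative radii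
`r_i` of the averaged pairs are the next files.  CURRENCY: `λ` is proportional to `a_U + a_W + r` — at level `i` of the class `a_i ≍ L^{2i}·b∕M²`,
`r_i ≍ L^i·α̂∕M`, so `Σ_i λ_i = O(b + α̂)` uniformly in the number of levels (memo §2 (L4): any level-uniform `Λ = O(small·M^{1−d})` suffices).
WHAT ([folklore]; 0 def, 0 sorry).
§1 gauge bookkeeping: `gaugeAct_eq_mul_conj` (`U^g = W^g·Ad_{g(x+e_μ)}(W⁻¹U)` bondwise), `norm_gaugeAct_sub_one_le_add` (`‖U^g − 1‖ ≤ ‖W^g − 1‖ + ‖W⁻¹U − 1‖`),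
   `norm_le_dirL1_box` (a bond norm against the box `ℓ¹` weight).
§2 **`norm_Qbar_sub_Qbar_le`** (per coarse bond): `‖Q̄_U Y(z,κ) − Q̄_W Y(z,κ)‖ ≤ ((2d+4)L²(2n_b·a_W + r) + (8L + C_sup)(loopRad a_U + loopRad a_W))·s`, `s` the sup of
   `‖Y‖` on the `n_b`-ball about `L•z`.
§3 **`sum_norm_Qbar_sub_Qbar_le`** — THE ONE-LEVEL LETTER ON THE TORUS: for an `(L·M)`-periodic `Y`,
   `Σ_{z∈[0,M)^d} Σ_κ ‖Q̄_U Y − Q̄_W Y‖(z,κ) ≤ d(2n_b+1)^d·((2d+4)L²(2n_b·a_W + r) + (8L + C_sup)(loopRad a_U + loopRad a_W))·‖Y‖_{ℓ¹([0,LM)^d)}`.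
HONEST FRAMING (page 1): one-level lattice kinematics over tree lemmas; the tower, the relative radii of the averaged pairs, the TT assembly and (APE) are NOT
here; nothing of Bałaban's asserted; NOT ONE-STEP, NOT NE7; spine 0∕9; finite T⁴ rung (B)+1 — NOT infinite volume, NOT mass gap, NOT `BetaPertH`, NOT Clay.
Continuum YM on T⁴ ⇐ BetaPertH ∧ nine spine estimates (0/9 proved); BetaPertH ⇐ (D1) ∧ (D4) ∧ CAP+tail; G-an2-4 gates asym, D1 and NE2/3/4.
-/

set_option autoImplicit false

open scoped BigOperators Matrix.Norms.L2Operator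
open Finset

namespace Summit.QuantumFields.BalabanUV.T4Continuum.NE7QbarCurvedBaseLetter

open Literature.MathematicalPhysics.QuantumFieldTheory.Balaban1983to89
open B7Prop1Explicit B7Prop2Explicit
open T4AveragingDeficitWall (IsUnitaryCfg SmallField Ad dirL1 box)
open T4AveragingDeficitWallBoundary (periodBox)
open T4AveragingDeficitNonAbelian (Ad_sub)
open AveragingDeficitTransport (norm_Ad_of_unitary mem_U1_of_unitary)
open AveragingDeficitPeriodicCounting (IsPeriodicDir sum_periodBox_box_le natCast_mul_period)
open AveragingDeficitPlaqLin (mem_box_of_l1)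
open SpreadLift (loopRad)
open B7Prop3Flat (linQ)
open BlockAverageVaryHolo (nbRad)
open NE3TangentCovariantStructure (Qbar)
open NE3QbarNearFlat (norm_Qbar_sub_linQ_le)
open NE3QbarGaugeCovariance (Qbar_gaugeAct)

noncomputable section

variable {d : ℕ} {n : Type*} [Fintype n] [DecidableEq n]

/-! ## §1 Gauge bookkeeping -/

/-- `U^g(x,μ) = W^g(x,μ) · (g(x+e_μ)·(W(x,μ)⁻¹U(x,μ))·g(x+e_μ)⁻¹)` — the relative link variable dresses by conjugation at the far endpoint. [folklore] -/
theorem gaugeAct_eq_mul_conj (g : Site d → (Matrix n n ℂ)ˣ) (U W : Site d → Fin d → (Matrix n n ℂ)ˣ) (x : Site d) (μ : Fin d) :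
    gaugeAct g U x μ = gaugeAct g W x μ * (g (x + e μ) * ((W x μ)⁻¹ * U x μ) * (g (x + e μ))⁻¹) := by
  unfold gaugeAct
  group

/-- **THE RELATIVE LINK RADIUS IS GAUGE INVARIANT, SO IT ADDS**: for unitary `g`, `‖U^g(x,μ) − 1‖ ≤ ‖W^g(x,μ) − 1‖ + ‖W(x,μ)⁻¹U(x,μ) − 1‖` (unitary `W`). [folklore] -/
theorem norm_gaugeAct_sub_one_le_add [Nonempty n] {g : Site d → (Matrix n n ℂ)ˣ} (hg : ∀ x, g x ∈ unitaryUnits (Matrix n n ℂ))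
    {U W : Site d → Fin d → (Matrix n n ℂ)ˣ} (hWu : IsUnitaryCfg W) (x : Site d) (μ : Fin d) :
    ‖((gaugeAct g U x μ : (Matrix n n ℂ)ˣ) : Matrix n n ℂ) - 1‖
      ≤ ‖((gaugeAct g W x μ : (Matrix n n ℂ)ˣ) : Matrix n n ℂ) - 1‖ + ‖(((W x μ)⁻¹ * U x μ : (Matrix n n ℂ)ˣ) : Matrix n n ℂ) - 1‖ := by
  set A : (Matrix n n ℂ)ˣ := gaugeAct g W x μ with hA
  set B : (Matrix n n ℂ)ˣ := g (x + e μ) * ((W x μ)⁻¹ * U x μ) * (g (x + e μ))⁻¹ with hB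
  have hgU : ∀ y, g y ∈ U1 (Matrix n n ℂ) := fun y => mem_U1_of_unitary (hg y)
  have hAU : A ∈ U1 (Matrix n n ℂ) := by
    rw [hA]
    exact gaugeAct_mem (fun y ν => mem_U1_of_unitary (hWu y ν)) hgU x μ
  have hBle : ‖(B : Matrix n n ℂ) - 1‖ ≤ ‖(((W x μ)⁻¹ * U x μ : (Matrix n n ℂ)ˣ) : Matrix n n ℂ) - 1‖ := by
    rw [hB, Units.val_mul, Units.val_mul]
    exact norm_units_conj_sub_one_le (hgU _) _
  have hid : ((gaugeAct g U x μ : (Matrix n n ℂ)ˣ) : Matrix n n ℂ) - 1 = (A : Matrix n n ℂ) * ((B : Matrix n n ℂ) - 1) + ((A : Matrix n n ℂ) - 1) := by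
    rw [gaugeAct_eq_mul_conj g U W x μ, ← hA, ← hB, Units.val_mul]
    noncomm_ring
  rw [hid]
  have h1 : ‖(A : Matrix n n ℂ) * ((B : Matrix n n ℂ) - 1)‖ ≤ ‖(B : Matrix n n ℂ) - 1‖ :=
    (norm_mul_le _ _).trans (by nlinarith [(mem_U1.mp hAU).1, norm_nonneg ((B : Matrix n n ℂ) - 1)])
  linarith [norm_add_le ((A : Matrix n n ℂ) * ((B : Matrix n n ℂ) - 1)) ((A : Matrix n n ℂ) - 1)]

/-- A single bond norm against the box `ℓ¹` weight: `‖Y(x′,μ)‖ ≤ dirL1 Y (box R q)` whenever `|x′ − q|₁ ≤ R`. [folklore] -/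
theorem norm_le_dirL1_box (Y : Site d → Fin d → Matrix n n ℂ) {R : ℕ} {q x' : Site d} (hx' : l1 (x' - q) ≤ R) (μ : Fin d) :
    ‖Y x' μ‖ ≤ dirL1 Y (box R q) := by
  unfold dirL1
  calc ‖Y x' μ‖ ≤ ∑ κ : Fin d, ‖Y x' κ‖ := Finset.single_le_sum (f := fun κ => ‖Y x' κ‖) (fun _ _ => norm_nonneg _) (Finset.mem_univ μ)
    _ ≤ ∑ x ∈ box R q, ∑ κ : Fin d, ‖Y x κ‖ :=
        Finset.single_le_sum (f := fun x => ∑ κ : Fin d, ‖Y x κ‖) (fun _ _ => Finset.sum_nonneg fun _ _ => norm_nonneg _) (mem_box_of_l1 hx')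

/-! ## §2 Per coarse bond: both backgrounds in one local axial gauge of `W` -/

/-- **THE ONE-LEVEL BASE-LIPSCHITZ LETTER, PER COARSE BOND.**  `U`, `W` unitary with `SmallField U a_U`, `SmallField W a_W` (`512(d+1)(d+4)L²a ≤ 1` each),
relative link radius `‖W(x,μ)⁻¹U(x,μ) − 1‖ ≤ r` everywhere, and `‖Y‖ ≤ s` on the `nbRad`-ball about `L•z`.  Then
`‖Q̄_U Y (z,κ) − Q̄_W Y (z,κ)‖ ≤ ((2d+4)L²(2·nbRad·a_W + r) + (8L + C_sup)(loopRad a_U + loopRad a_W))·s`.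
(Both readings taken in the axial gauge of `W` rooted at `L•z`; W4a against the common flat straight average of the dressed direction.) [folklore] -/
theorem norm_Qbar_sub_Qbar_le [Nonempty n] {L : ℕ} (hL : 1 ≤ L) {U W : Site d → Fin d → (Matrix n n ℂ)ˣ} (hUu : IsUnitaryCfg U) (hWu : IsUnitaryCfg W)
    {aU aW : ℝ} (haU : 0 ≤ aU) (haW : 0 ≤ aW) (h512U : 512 * (d + 1) * (d + 4) * (L : ℝ) ^ 2 * aU ≤ 1) (h512W : 512 * (d + 1) * (d + 4) * (L : ℝ) ^ 2 * aW ≤ 1)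
    (hUa : SmallField U aU) (hWa : SmallField W aW)
    {r : ℝ} (hr : ∀ (x : Site d) (μ : Fin d), ‖(((W x μ)⁻¹ * U x μ : (Matrix n n ℂ)ˣ) : Matrix n n ℂ) - 1‖ ≤ r)
    (Y : Site d → Fin d → Matrix n n ℂ) (z : Site d) (κ : Fin d) {s : ℝ}
    (hY : ∀ (x' : Site d) (μ : Fin d), l1 (x' - (L : ℤ) • z) ≤ nbRad d L → ‖Y x' μ‖ ≤ s) :
    ‖Qbar L U Y z κ - Qbar L W Y z κ‖
      ≤ ((2 * (d : ℝ) + 4) * (L : ℝ) ^ 2 * (2 * ((nbRad d L : ℝ) * aW) + r)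
          + (8 * (L : ℝ) + (1250 * ((nbRad d L : ℝ) + L) + 8 * (d * L) + 2 * L)) * (loopRad d L aU + loopRad d L aW)) * s := by
  -- the local axial gauge of `W` rooted at the base corner `q = L•z`
  set q : Site d := (L : ℤ) • z with hq
  set g : Site d → (Matrix n n ℂ)ˣ := axialFn W q with hg
  have hgu : ∀ x, g x ∈ unitaryUnits (Matrix n n ℂ) := fun x => hol_mem_of (S := unitaryUnits (Matrix n n ℂ)) hWu _ _
  have hgU : ∀ x, g x ∈ U1 (Matrix n n ℂ) := fun x => mem_U1_of_unitary (hgu x)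
  have hWU1 : ∀ x ν, W x ν ∈ U1 (Matrix n n ℂ) := fun x ν => mem_U1_of_unitary (hWu x ν)
  have hUU1 : ∀ x ν, U x ν ∈ U1 (Matrix n n ℂ) := fun x ν => mem_U1_of_unitary (hUu x ν)
  set Ug : Site d → Fin d → (Matrix n n ℂ)ˣ := gaugeAct g U with hUg
  set Wg : Site d → Fin d → (Matrix n n ℂ)ˣ := gaugeAct g W with hWg
  set Yg : Site d → Fin d → Matrix n n ℂ := fun x μ => Ad (g (x + e μ)) (Y x μ) with hYgdef
  -- the dressed data: unitary, same plaquette radii, same direction norms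
  have hunit : ∀ {V : Site d → Fin d → (Matrix n n ℂ)ˣ}, IsUnitaryCfg V → IsUnitaryCfg (gaugeAct g V) := fun hV x ν =>
    (unitaryUnits _).mul_mem ((unitaryUnits _).mul_mem (hgu x) (hV x ν)) ((unitaryUnits _).inv_mem (hgu _))
  have hsmall : ∀ {V : Site d → Fin d → (Matrix n n ℂ)ˣ} {a : ℝ}, SmallField V a → SmallField (gaugeAct g V) a := by
    intro V a hV x ν ν' hne
    rw [hol_gaugeAct_closed _ _ _ _ (disp_plaqWord _ _), Units.val_mul, Units.val_mul]
    exact (norm_units_conj_sub_one_le (hgU x) _).trans (hV x ν ν' hne)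
  have hYgn : ∀ x μ, ‖Yg x μ‖ = ‖Y x μ‖ := fun x μ => norm_Ad_of_unitary (hgu _) _
  have hYg : ∀ (x' : Site d) (μ : Fin d), l1 (x' - (L : ℤ) • z) ≤ nbRad d L → ‖Yg x' μ‖ ≤ s := fun x' μ h => by rw [hYgn]; exact hY x' μ h
  -- the links of `W^g` and `U^g` on the stencil ball
  have hWlink : ∀ (x' : Site d) (μ : Fin d), l1 (x' - (L : ℤ) • z) ≤ nbRad d L →
      ‖((Wg x' μ : (Matrix n n ℂ)ˣ) : Matrix n n ℂ) - 1‖ ≤ (nbRad d L : ℝ) * aW := by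
    intro x' μ hx'
    have h := axial_bond_bound W hWU1 q hWa haW x' μ
    rw [← hg, ← hWg] at h
    exact h.trans (mul_le_mul_of_nonneg_right (by exact_mod_cast hx') haW)
  have hUlink : ∀ (x' : Site d) (μ : Fin d), l1 (x' - (L : ℤ) • z) ≤ nbRad d L →
      ‖((Ug x' μ : (Matrix n n ℂ)ˣ) : Matrix n n ℂ) - 1‖ ≤ (nbRad d L : ℝ) * aW + r := fun x' μ hx' =>
    (norm_gaugeAct_sub_one_le_add hgu hWu x' μ).trans (add_le_add (hWlink x' μ hx') (hr x' μ))
  -- W4a for each dressed background against the common flat straight average of `Y^g`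
  have hδW : 0 ≤ (nbRad d L : ℝ) * aW := by positivity
  have hr0 : 0 ≤ r := (norm_nonneg _).trans (hr q κ)
  have hW4 := norm_Qbar_sub_linQ_le hL (hunit hWu) haW h512W (hsmall hWa) z κ hδW hWlink Yg hYg
  have hU4 := norm_Qbar_sub_linQ_le hL (hunit hUu) haU h512U (hsmall hUa) z κ (by positivity) hUlink Yg hYg
  -- undress: `Q̄_{V^g} Y^g (z,κ) = Ad_{g(L•(z+e_κ))} Q̄_V Y (z,κ)`
  have hQU : Qbar L Ug Yg z κ = Ad (g ((L : ℤ) • (z + e κ))) (Qbar L U Y z κ) := by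
    rw [hUg, hYgdef, Qbar_gaugeAct hL hUu haU h512U hUa hgu Y]
  have hQW : Qbar L Wg Yg z κ = Ad (g ((L : ℤ) • (z + e κ))) (Qbar L W Y z κ) := by
    rw [hWg, hYgdef, Qbar_gaugeAct hL hWu haW h512W hWa hgu Y]
  have hs : 0 ≤ s := (norm_nonneg _).trans (hY q κ (by rw [hq, sub_self]; simp [l1]))
  calc ‖Qbar L U Y z κ - Qbar L W Y z κ‖
      = ‖Ad (g ((L : ℤ) • (z + e κ))) (Qbar L U Y z κ - Qbar L W Y z κ)‖ := (norm_Ad_of_unitary (hgu _) _).symm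
    _ = ‖(Qbar L Ug Yg z κ - linQ L Yg ((L : ℤ) • z) κ) - (Qbar L Wg Yg z κ - linQ L Yg ((L : ℤ) • z) κ)‖ := by
        rw [Ad_sub, ← hQU, ← hQW, sub_sub_sub_cancel_right]
    _ ≤ ‖Qbar L Ug Yg z κ - linQ L Yg ((L : ℤ) • z) κ‖ + ‖Qbar L Wg Yg z κ - linQ L Yg ((L : ℤ) • z) κ‖ := norm_sub_le _ _
    _ ≤ _ := add_le_add hU4 hW4
    _ = _ := by ring

/-! ## §3 THE ONE-LEVEL LETTER ON THE TORUS -/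

/-- **THE ONE-LEVEL `ℓ¹` BASE-LIPSCHITZ LETTER OF THE DOUBLE-BAR AVERAGE AT A CURVED BACKGROUND, ON THE TORUS.**  `L, M ≥ 1`; `U`, `W` unitary with
`SmallField U a_U`, `SmallField W a_W` (`512(d+1)(d+4)L²a ≤ 1` each); relative link radius `‖W⁻¹U − 1‖ ≤ r`; `Y` an `(L·M)`-periodic direction field.  Then
`Σ_{z∈[0,M)^d} Σ_κ ‖Q̄_U Y (z,κ) − Q̄_W Y (z,κ)‖ ≤ d·(2nbRad+1)^d·((2d+4)L²(2nbRad·a_W + r) + (8L + C_sup)(loopRad a_U + loopRad a_W))·‖Y‖_{ℓ¹([0,LM)^d)}`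
(§2 with `s` the box `ℓ¹` weight of `Y` about `L•z`, then the torus box multiplicity). [folklore] -/
theorem sum_norm_Qbar_sub_Qbar_le [Nonempty n] {L M : ℕ} (hL : 1 ≤ L) (hM : 1 ≤ M) {U W : Site d → Fin d → (Matrix n n ℂ)ˣ}
    (hUu : IsUnitaryCfg U) (hWu : IsUnitaryCfg W) {aU aW : ℝ} (haU : 0 ≤ aU) (haW : 0 ≤ aW)
    (h512U : 512 * (d + 1) * (d + 4) * (L : ℝ) ^ 2 * aU ≤ 1) (h512W : 512 * (d + 1) * (d + 4) * (L : ℝ) ^ 2 * aW ≤ 1)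
    (hUa : SmallField U aU) (hWa : SmallField W aW)
    {r : ℝ} (hr0 : 0 ≤ r) (hr : ∀ (x : Site d) (μ : Fin d), ‖(((W x μ)⁻¹ * U x μ : (Matrix n n ℂ)ˣ) : Matrix n n ℂ) - 1‖ ≤ r)
    (Y : Site d → Fin d → Matrix n n ℂ) (hY : IsPeriodicDir Y ((L : ℤ) * M)) :
    ∑ z ∈ periodBox M, ∑ κ : Fin d, ‖Qbar L U Y z κ - Qbar L W Y z κ‖
      ≤ ((d : ℝ) * (2 * nbRad d L + 1) ^ d
          * ((2 * (d : ℝ) + 4) * (L : ℝ) ^ 2 * (2 * ((nbRad d L : ℝ) * aW) + r)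
              + (8 * (L : ℝ) + (1250 * ((nbRad d L : ℝ) + L) + 8 * (d * L) + 2 * L)) * (loopRad d L aU + loopRad d L aW)))
        * dirL1 Y (periodBox (L * M)) := by
  set Θ : ℝ := (2 * (d : ℝ) + 4) * (L : ℝ) ^ 2 * (2 * ((nbRad d L : ℝ) * aW) + r)
      + (8 * (L : ℝ) + (1250 * ((nbRad d L : ℝ) + L) + 8 * (d * L) + 2 * L)) * (loopRad d L aU + loopRad d L aW) with hΘ
  have hlU : 0 ≤ loopRad d L aU := by unfold loopRad; positivity
  have hlW : 0 ≤ loopRad d L aW := by unfold loopRad; positivity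
  have hΘ0 : 0 ≤ Θ := by rw [hΘ]; positivity
  -- (1) per bond, against the box `ℓ¹` weight
  have hpt : ∀ (y : Site d) (κ : Fin d), ‖Qbar L U Y y κ - Qbar L W Y y κ‖ ≤ Θ * dirL1 Y (box (nbRad d L) ((L : ℤ) • y)) := by
    intro y κ
    have h := norm_Qbar_sub_Qbar_le hL hUu hWu haU haW h512U h512W hUa hWa hr Y y κ (s := dirL1 Y (box (nbRad d L) ((L : ℤ) • y)))
      (fun x' μ hx' => norm_le_dirL1_box Y hx' μ)
    rw [hΘ]; exact h
  -- (2) the box multiplicity on the torus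
  have hbox : ∑ y ∈ periodBox M, dirL1 Y (box (nbRad d L) ((L : ℤ) • y))
      ≤ (2 * nbRad d L + 1) ^ d * dirL1 Y (periodBox (L * M)) := by
    unfold dirL1
    refine sum_periodBox_box_le L M hL hM (nbRad d L) (fun _ => Finset.sum_nonneg fun _ _ => norm_nonneg _) fun x κ => ?_
    rw [natCast_mul_period]
    exact Finset.sum_congr rfl fun μ _ => by rw [hY x κ μ]
  have hD0 : 0 ≤ dirL1 Y (periodBox (d := d) (L * M)) := by
    unfold dirL1; exact Finset.sum_nonneg fun _ _ => Finset.sum_nonneg fun _ _ => norm_nonneg _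
  -- (3) assemble
  calc ∑ z ∈ periodBox M, ∑ κ : Fin d, ‖Qbar L U Y z κ - Qbar L W Y z κ‖
      ≤ ∑ z ∈ periodBox M, ∑ _κ : Fin d, Θ * dirL1 Y (box (nbRad d L) ((L : ℤ) • z)) :=
        Finset.sum_le_sum fun z _ => Finset.sum_le_sum fun κ _ => hpt z κ
    _ = Θ * ((d : ℝ) * ∑ z ∈ periodBox M, dirL1 Y (box (nbRad d L) ((L : ℤ) • z))) := by
        simp only [Finset.sum_const, Finset.card_univ, Fintype.card_fin, nsmul_eq_mul, Finset.mul_sum]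
        exact Finset.sum_congr rfl fun z _ => by ring
    _ ≤ Θ * ((d : ℝ) * ((2 * nbRad d L + 1) ^ d * dirL1 Y (periodBox (L * M)))) :=
        mul_le_mul_of_nonneg_left (mul_le_mul_of_nonneg_left hbox (Nat.cast_nonneg _)) hΘ0
    _ = ((d : ℝ) * (2 * nbRad d L + 1) ^ d * Θ) * dirL1 Y (periodBox (L * M)) := by ring

end

end Summit.QuantumFields.BalabanUV.T4Continuum.NE7QbarCurvedBaseLetter
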